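import Summits.HubbardSuperconductivity.HubbardSuperconductivity.Theorems.LevyLogBootstrapLevyTransportPointwiseAnchor
import Summits.HubbardSuperconductivity.HubbardSuperconductivity.Theorems.LevyLogBootstrapLevyTransportLogBootstrapInputs
import Literature.Probability.LatticeModels.TorusBlockKernelFlatness
import HarnessLib

/-!
# Crux `LevyTransport` (stmt-HubbardSuperconductivity-15049), input (c) continued:
# the Lévy mass of large blocks under long-range order — `|ν_b| ≤ log (1/a)`, `|ν_b| ≤ log 3`

Sequel of `LevyLogBootstrapLevyTransportPointwiseAnchor.lean` (pointwise block floor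
`k_b(X) ≥ b⁴Λ_ψ/M⁴ - 18√(1-Δ)b³` for half-filled sector ground states of `H_M(Δ)`, `Δ ≤ 0`). Here the
floor is turned into the quantity the log-bootstrap consumes, the coarse LÉVY MASS
`m^{-2} Σ_X (log k_b(0) - log k_b(X))` of the `b`-block transverse kernel: if the planar order
parameter obeys `Λ_ψ = Σ_{x,y} Re⟨ψ,S⁺_xS⁻_yψ⟩ ≥ a M⁴` and the block is large, `a·b ≥ 36√(1-Δ)`, then

* `sectorGS_coarseKernel_le` — `k_b(X) ≤ b⁴/2` (each term `≤ ½`);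
* `sectorGS_coarseLevyMass_le` — `|ν_b| ≤ log (1/a)`;
* `sectorGS_abs_coarseKernel_sub_le` — two-sided flatness `|k_b(X) - b⁴Λ_ψ/M⁴| ≤ 18√(1-Δ) b³`
  (`TorusBlock.abs_coarseKernel_sub_coherent_le`);
* `sectorGS_coarseLevyMass_le_log_three` — hence the `a`-independent anchor `|ν_b| ≤ log 3`.

So at every `Δ ≤ 0` where planar long-range order is known (Δ = 0: Kennedy–Lieb–Shastry,
`AnisotropyChord.sectorAnchorXY_proof`; `[-0.109, 0]`: `halfFilledOrder_window`) the Lévy mass of the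
`b`-block kernel is bounded uniformly in `M` from the block size `b₀(Δ) = 36√(1-Δ)/a(Δ)` on — the
anchor `|ν|(0) ≤ const` of `stub_logBootstrap` (input (c)), derived from input (a) alone; and the
converse of the Jensen floor `f ≥ e^{-|ν|}` (`LevyJensenFloor`): for large blocks
`|ν_b| = O(√(1-Δ)/(a b))`.

Sources: T. Kennedy, E. H. Lieb, B. S. Shastry, J. Stat. Phys. 53 (1988) 1019; J. E. Björnberg,
D. Ueltschi (2022), arXiv:2204.12896, Lemma 4.4. No definition is introduced; sorry-free.
-/

noncomputable section

set_option linter.dupNamespace false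

namespace Summit.HubbardSuperconductivity.HubbardSuperconductivity.Theorems.LevyLogBootstrap

open scoped BigOperators Matrix ComplexOrder ComplexConjugate
open Matrix Finset Complex
open Literature.MathematicalPhysics.QuantumLattice Literature.Probability.LatticeModels

section Main

variable (M : ℕ) {m b : ℕ} [NeZero M] [NeZero m]

/-! ### The Lévy mass under long-range order: `|ν| ≤ log (1/a)` for large blocks -/

/-- **The coarse block kernel of a half-filled ground state is at most `b⁴/2`**: each of the
`b² × b²` terms of the block sum is `≤ ½` (`transverseKernel_le_half`, `TorusBlock.card_filter_block`).
[folklore] -/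
theorem sectorGS_coarseKernel_le (hMb : M = b * m) (hEven : Even M) (Δ : ℝ)
    (ψ : TensorIndex (TorusSite 2 M) 2 → ℂ)
    (hψ : ψ ∈ @spinZSector (TorusSite 2 M) _ _ 1 0) (hnorm : star ψ ⬝ᵥ ψ = 1)
    (heig : Matrix.mulVec (xxzHamiltonian 1 (torusGraph 2 M) (-1) Δ) ψ =
      ((lowestEnergyInSector 1 (xxzHamiltonian 1 (torusGraph 2 M) (-1) Δ) 0 : ℝ) : ℂ) • ψ)
    (X : TorusSite 2 m) :
    (∑ x' : TorusSite 2 M, ∑ y' : TorusSite 2 M,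
        if (∀ i : Fin 2, (x' i).val / b = (X i).val) ∧ (∀ i : Fin 2, (y' i).val / b = 0)
        then (star ψ ⬝ᵥ (onSite x' (spinRaise 1) * onSite y' (spinLower 1)) *ᵥ ψ).re else 0) ≤
      (b : ℝ) ^ 4 / 2 := by
  classical
  have hterm : ∀ x' y' : TorusSite 2 M,
      (if (∀ i : Fin 2, (x' i).val / b = (X i).val) ∧ (∀ i : Fin 2, (y' i).val / b = 0)
        then (star ψ ⬝ᵥ (onSite x' (spinRaise 1) * onSite y' (spinLower 1)) *ᵥ ψ).re else 0) ≤
      (if ∀ i : Fin 2, (x' i).val / b = (X i).val then (1 : ℝ) else 0) *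
        (if ∀ i : Fin 2, (y' i).val / b = 0 then (1 : ℝ) else 0) * (1 / 2) := by
    intro x' y'
    have h := transverseKernel_le_half M hEven Δ ψ hψ hnorm heig x' y'
    by_cases h1 : ∀ i : Fin 2, (x' i).val / b = (X i).val
    · by_cases h2 : ∀ i : Fin 2, (y' i).val / b = 0
      · rw [if_pos ⟨h1, h2⟩, if_pos h1, if_pos h2]; linarith
      · rw [if_neg (fun h' => h2 h'.2), if_pos h1, if_neg h2]; norm_num
    · by_cases h2 : ∀ i : Fin 2, (y' i).val / b = 0
      · rw [if_neg (fun h' => h1 h'.1), if_neg h1, if_pos h2]; norm_num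
      · rw [if_neg (fun h' => h1 h'.1), if_neg h1, if_neg h2]; norm_num
  have hcx : ∑ x' : TorusSite 2 M, (if ∀ i : Fin 2, (x' i).val / b = (X i).val then (1 : ℝ) else 0) =
      (b : ℝ) ^ 2 := by
    rw [Finset.sum_boole, TorusBlock.card_filter_block hMb X, Nat.cast_pow]
  have hcy : ∑ y' : TorusSite 2 M, (if ∀ i : Fin 2, (y' i).val / b = 0 then (1 : ℝ) else 0) =
      (b : ℝ) ^ 2 := by
    have h0 : ∀ y' : TorusSite 2 M, (∀ i : Fin 2, (y' i).val / b = 0) ↔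
        (∀ i : Fin 2, (y' i).val / b = ((0 : TorusSite 2 m) i).val) := fun y' => by
      refine forall_congr' fun i => ?_
      rw [Pi.zero_apply, ZMod.val_zero]
    rw [Finset.sum_boole]
    rw [show (Finset.univ.filter fun y' : TorusSite 2 M => ∀ i : Fin 2, (y' i).val / b = 0) =
        Finset.univ.filter fun y' : TorusSite 2 M => ∀ i : Fin 2, (y' i).val / b = ((0 : TorusSite 2 m) i).val
      from Finset.filter_congr fun y' _ => h0 y', TorusBlock.card_filter_block hMb 0, Nat.cast_pow]
  calc (∑ x' : TorusSite 2 M, ∑ y' : TorusSite 2 M,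
        if (∀ i : Fin 2, (x' i).val / b = (X i).val) ∧ (∀ i : Fin 2, (y' i).val / b = 0)
        then (star ψ ⬝ᵥ (onSite x' (spinRaise 1) * onSite y' (spinLower 1)) *ᵥ ψ).re else 0)
      ≤ ∑ x' : TorusSite 2 M, ∑ y' : TorusSite 2 M,
          (if ∀ i : Fin 2, (x' i).val / b = (X i).val then (1 : ℝ) else 0) *
          (if ∀ i : Fin 2, (y' i).val / b = 0 then (1 : ℝ) else 0) * (1 / 2) :=
        Finset.sum_le_sum fun x' _ => Finset.sum_le_sum fun y' _ => hterm x' y'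
    _ = (∑ x' : TorusSite 2 M, (if ∀ i : Fin 2, (x' i).val / b = (X i).val then (1 : ℝ) else 0)) *
          (∑ y' : TorusSite 2 M, (if ∀ i : Fin 2, (y' i).val / b = 0 then (1 : ℝ) else 0)) *
          (1 / 2) := by
        rw [Finset.sum_mul_sum, Finset.sum_mul]
        refine Finset.sum_congr rfl fun x' _ => ?_
        rw [Finset.sum_mul]
    _ = (b : ℝ) ^ 4 / 2 := by rw [hcx, hcy]; ring

/-- **Lévy mass under long-range order** (`d = 2`, any block size): for `M = b·m` even, `M ≥ 4`,
`Δ ≤ 0`, a normalised half-filled sector ground state `ψ` with planar order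
`Σ_{x,y} Re⟨ψ,S⁺_xS⁻_yψ⟩ ≥ a M⁴` and a block size with `a·b ≥ 36√(1-Δ)`: every coarse block entry is
`≥ (a/2) b⁴`, `k_b(0) ≤ b⁴/2`, hence the coarse Lévy mass is at most `log (1/a)`:
`m^{-2} Σ_X (log k_b(0) - log k_b(X)) ≤ log (1/a)` — the converse direction of the Jensen floor
`f ≥ e^{-|ν|}` (`LevyJensenFloor`): for large blocks the Lévy mass is `log(1/condensate density) + O(1)`.
This is the `Δ = 0` anchor `|ν|(0) ≤ const` of the log-bootstrap with `const = log (1/a₀)`, `a₀` the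
Kennedy–Lieb–Shastry constant. [cite: KLS1988JSP, eqs. (17)–(19)] -/
theorem sectorGS_coarseLevyMass_le (hMb : M = b * m) (hEven : Even M) (h4 : 4 ≤ M) {Δ : ℝ}
    (hΔ : Δ ≤ 0) (ψ : TensorIndex (TorusSite 2 M) 2 → ℂ)
    (hψ : ψ ∈ @spinZSector (TorusSite 2 M) _ _ 1 0) (hnorm : star ψ ⬝ᵥ ψ = 1)
    (heig : Matrix.mulVec (xxzHamiltonian 1 (torusGraph 2 M) (-1) Δ) ψ =
      ((lowestEnergyInSector 1 (xxzHamiltonian 1 (torusGraph 2 M) (-1) Δ) 0 : ℝ) : ℂ) • ψ)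
    {a : ℝ} (ha : a * (M : ℝ) ^ 4 ≤ ∑ x : TorusSite 2 M, ∑ y : TorusSite 2 M,
      (star ψ ⬝ᵥ (onSite x (spinRaise 1) * onSite y (spinLower 1)) *ᵥ ψ).re)
    (hab : 36 * Real.sqrt (1 - Δ) ≤ a * b) :
    (∑ X : TorusSite 2 m, (Real.log (∑ x' : TorusSite 2 M, ∑ y' : TorusSite 2 M,
        if (∀ i : Fin 2, (x' i).val / b = ((0 : TorusSite 2 m) i).val) ∧ (∀ i : Fin 2, (y' i).val / b = 0)
        then (star ψ ⬝ᵥ (onSite x' (spinRaise 1) * onSite y' (spinLower 1)) *ᵥ ψ).re else 0) -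
      Real.log (∑ x' : TorusSite 2 M, ∑ y' : TorusSite 2 M,
        if (∀ i : Fin 2, (x' i).val / b = (X i).val) ∧ (∀ i : Fin 2, (y' i).val / b = 0)
        then (star ψ ⬝ᵥ (onSite x' (spinRaise 1) * onSite y' (spinLower 1)) *ᵥ ψ).re else 0))) /
      (m : ℝ) ^ 2 ≤ Real.log (1 / a) := by
  classical
  set k : TorusSite 2 m → ℝ := fun X => ∑ x' : TorusSite 2 M, ∑ y' : TorusSite 2 M,
      if (∀ i : Fin 2, (x' i).val / b = (X i).val) ∧ (∀ i : Fin 2, (y' i).val / b = 0)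
      then (star ψ ⬝ᵥ (onSite x' (spinRaise 1) * onSite y' (spinLower 1)) *ᵥ ψ).re else 0 with hk
  have hMpos : (0 : ℝ) < M := by exact_mod_cast Nat.pos_of_ne_zero (NeZero.ne M)
  have hmpos : (0 : ℝ) < m := by exact_mod_cast Nat.pos_of_ne_zero (NeZero.ne m)
  have hb : (0 : ℝ) < b := by exact_mod_cast TorusBlock.pos_of_eq_mul hMb
  have hs1 : 1 ≤ Real.sqrt (1 - Δ) := Real.le_sqrt_of_sq_le (by nlinarith)
  have hapos : 0 < a := by
    by_contra h
    push Not at h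
    have : a * b ≤ 0 := mul_nonpos_of_nonpos_of_nonneg h hb.le
    linarith
  -- pointwise floor `k X ≥ (a/2) b⁴`
  have hfloor : ∀ X, a / 2 * (b : ℝ) ^ 4 ≤ k X := by
    intro X
    have h := sectorGS_coarseKernel_floor M hMb hEven h4 hΔ ψ hψ hnorm heig X
    have h1 : a * (b : ℝ) ^ 4 ≤ (b : ℝ) ^ 4 * (∑ x : TorusSite 2 M, ∑ y : TorusSite 2 M,
        (star ψ ⬝ᵥ (onSite x (spinRaise 1) * onSite y (spinLower 1)) *ᵥ ψ).re) / (M : ℝ) ^ 4 := by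
      rw [le_div_iff₀ (by positivity)]
      nlinarith [pow_pos hb 4]
    have h2 : 18 * Real.sqrt (1 - Δ) * (b : ℝ) ^ 3 ≤ a / 2 * (b : ℝ) ^ 4 := by
      have : 18 * Real.sqrt (1 - Δ) ≤ a * b / 2 := by linarith
      nlinarith [pow_pos hb 3]
    show a / 2 * (b : ℝ) ^ 4 ≤ k X
    simp only [hk]
    linarith
  have hℓ : 0 < a / 2 * (b : ℝ) ^ 4 := by positivity
  have hk0 : k 0 ≤ (b : ℝ) ^ 4 / 2 := sectorGS_coarseKernel_le M hMb hEven Δ ψ hψ hnorm heig 0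
  have hkpos : ∀ X, 0 < k X := fun X => hℓ.trans_le (hfloor X)
  have hterm : ∀ X, Real.log (k 0) - Real.log (k X) ≤ Real.log (1 / a) := by
    intro X
    have e1 : Real.log (k 0) ≤ Real.log ((b : ℝ) ^ 4 / 2) := Real.log_le_log (hkpos 0) hk0
    have e2 : Real.log (a / 2 * (b : ℝ) ^ 4) ≤ Real.log (k X) := Real.log_le_log hℓ (hfloor X)
    have e3 : Real.log ((b : ℝ) ^ 4 / 2) - Real.log (a / 2 * (b : ℝ) ^ 4) = Real.log (1 / a) := by
      rw [← Real.log_div (by positivity) (by positivity)]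
      congr 1
      field_simp
    linarith
  have hk00 : k 0 = ∑ x' : TorusSite 2 M, ∑ y' : TorusSite 2 M,
      if (∀ i : Fin 2, (x' i).val / b = ((0 : TorusSite 2 m) i).val) ∧ (∀ i : Fin 2, (y' i).val / b = 0)
      then (star ψ ⬝ᵥ (onSite x' (spinRaise 1) * onSite y' (spinLower 1)) *ᵥ ψ).re else 0 := rfl
  rw [← hk00]
  rw [div_le_iff₀ (by positivity)]
  calc ∑ X : TorusSite 2 m, (Real.log (k 0) - Real.log (k X))
      ≤ ∑ _X : TorusSite 2 m, Real.log (1 / a) := Finset.sum_le_sum fun X _ => hterm X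
    _ = Real.log (1 / a) * (m : ℝ) ^ 2 := by
        rw [Finset.sum_const, Finset.card_univ, TorusBlock.card_torusSite_eq_pow, nsmul_eq_mul]
        push_cast
        ring

/-- **Two-sided flatness on the route's objects**: under the same hypotheses,
`|k_b(X) - b⁴ (Σ_{x,y} K_ψ)/M⁴| ≤ 18 √(1-Δ) b³` for every coarse site `X`
(`TorusBlock.abs_coarseKernel_sub_coherent_le`). [cite: KLS1988JSP, eqs. (17)–(19)] -/
theorem sectorGS_abs_coarseKernel_sub_le (hMb : M = b * m) (hEven : Even M) (h4 : 4 ≤ M) {Δ : ℝ}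
    (hΔ : Δ ≤ 0) (ψ : TensorIndex (TorusSite 2 M) 2 → ℂ)
    (hψ : ψ ∈ @spinZSector (TorusSite 2 M) _ _ 1 0) (hnorm : star ψ ⬝ᵥ ψ = 1)
    (heig : Matrix.mulVec (xxzHamiltonian 1 (torusGraph 2 M) (-1) Δ) ψ =
      ((lowestEnergyInSector 1 (xxzHamiltonian 1 (torusGraph 2 M) (-1) Δ) 0 : ℝ) : ℂ) • ψ)
    (X : TorusSite 2 m) :
    |(∑ x' : TorusSite 2 M, ∑ y' : TorusSite 2 M,
        if (∀ i : Fin 2, (x' i).val / b = (X i).val) ∧ (∀ i : Fin 2, (y' i).val / b = 0)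
        then (star ψ ⬝ᵥ (onSite x' (spinRaise 1) * onSite y' (spinLower 1)) *ᵥ ψ).re else 0) -
      (b : ℝ) ^ 4 * (∑ x : TorusSite 2 M, ∑ y : TorusSite 2 M,
        (star ψ ⬝ᵥ (onSite x (spinRaise 1) * onSite y (spinLower 1)) *ᵥ ψ).re) / (M : ℝ) ^ 4| ≤
      18 * Real.sqrt (1 - Δ) * (b : ℝ) ^ 3 := by
  set K : TorusSite 2 M → TorusSite 2 M → ℝ := fun x y =>
    (star ψ ⬝ᵥ (onSite x (spinRaise 1) * onSite y (spinLower 1)) *ᵥ ψ).re with hK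
  have hT : ∀ v x y : TorusSite 2 M, K (x + v) (y + v) = K x y := fun v x y =>
    gs_transverseKernel_translate M hEven Δ ψ hψ hnorm heig v x y
  have hS : ∀ x y : TorusSite 2 M, K x y = K y x := fun x y => re_expect_raiseLower_symm 1 ψ x y
  have hP : ∀ c : TorusSite 2 M → ℝ, 0 ≤ ∑ x, ∑ y, c x * c y * K x y := fun c =>
    transverse_quadForm_nonneg 1 ψ c
  have hIR : ∀ k : TorusSite 2 M, k ≠ 0 →
      (torusFourier (fun z => (K 0 z : ℂ)) k).re ≤
        Real.sqrt (1 - Δ) / Real.sqrt (dispersion (latticeMomentum M k)) := by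
    intro k hk
    obtain ⟨h0, h1⟩ := sectorGS_transverse_infraredBound M hEven h4 hΔ ψ hψ hnorm heig k hk
    have hre := re_torusFourier_transverse_eq M ψ k
    simp only [hK]
    rw [hre]
    set Khat : ℝ := ∑ z : TorusSite 2 M, Real.cos (torusPhase M k z) *
      (star ψ ⬝ᵥ (onSite z (spinRaise 1) * onSite 0 (spinLower 1)) *ᵥ ψ).re
    set E : ℝ := dispersion (latticeMomentum M k) with hE
    have hE0 : 0 < E := by
      rcases (dispersion_nonneg (latticeMomentum M k)).lt_or_eq with h | h
      · exact h
      · exact absurd ((dispersion_latticeMomentum_eq_zero_iff_holds (d := 2) (L := M) k).1 h.symm) hk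
    have hsq : Khat ^ 2 ≤ (1 - Δ) / E := by rwa [le_div_iff₀ hE0]
    calc Khat ≤ Real.sqrt ((1 - Δ) / E) := Real.le_sqrt_of_sq_le hsq
      _ = Real.sqrt (1 - Δ) / Real.sqrt E := Real.sqrt_div' _ hE0.le
  exact TorusBlock.abs_coarseKernel_sub_coherent_le hMb K hT hS hP (Real.sqrt (1 - Δ))
    (Real.sqrt_nonneg _) hIR X

/-- **Lévy mass of large blocks is at most `log 3`** (and `→ 0`): for `M = b·m` even, `M ≥ 4`,
`Δ ≤ 0`, a normalised half-filled sector ground state with planar order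
`Σ_{x,y} Re⟨ψ,S⁺_xS⁻_yψ⟩ ≥ a M⁴` and `a·b ≥ 36√(1-Δ)`: by two-sided flatness every coarse block entry
lies in `[Λ' - c, Λ' + c]`, `Λ' = b⁴Σ_{x,y}K_ψ/M⁴ ≥ a b⁴`, `c = 18√(1-Δ)b³ ≤ Λ'/2`, so every term of
the coarse Lévy mass is `≤ log((Λ'+c)/(Λ'-c)) ≤ log 3`:
`m^{-2} Σ_X (log k_b(0) - log k_b(X)) ≤ log 3` — an `a`-INDEPENDENT anchor `|ν_b|(Δ) ≤ log 3` at every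
`Δ ≤ 0` with planar order, valid from the block size `b₀(Δ) = 36√(1-Δ)/a(Δ)` on.
[cite: KLS1988JSP, eqs. (17)–(19)] -/
theorem sectorGS_coarseLevyMass_le_log_three (hMb : M = b * m) (hEven : Even M) (h4 : 4 ≤ M) {Δ : ℝ}
    (hΔ : Δ ≤ 0) (ψ : TensorIndex (TorusSite 2 M) 2 → ℂ)
    (hψ : ψ ∈ @spinZSector (TorusSite 2 M) _ _ 1 0) (hnorm : star ψ ⬝ᵥ ψ = 1)
    (heig : Matrix.mulVec (xxzHamiltonian 1 (torusGraph 2 M) (-1) Δ) ψ =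
      ((lowestEnergyInSector 1 (xxzHamiltonian 1 (torusGraph 2 M) (-1) Δ) 0 : ℝ) : ℂ) • ψ)
    {a : ℝ} (ha : a * (M : ℝ) ^ 4 ≤ ∑ x : TorusSite 2 M, ∑ y : TorusSite 2 M,
      (star ψ ⬝ᵥ (onSite x (spinRaise 1) * onSite y (spinLower 1)) *ᵥ ψ).re)
    (hab : 36 * Real.sqrt (1 - Δ) ≤ a * b) :
    (∑ X : TorusSite 2 m, (Real.log (∑ x' : TorusSite 2 M, ∑ y' : TorusSite 2 M,
        if (∀ i : Fin 2, (x' i).val / b = ((0 : TorusSite 2 m) i).val) ∧ (∀ i : Fin 2, (y' i).val / b = 0)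
        then (star ψ ⬝ᵥ (onSite x' (spinRaise 1) * onSite y' (spinLower 1)) *ᵥ ψ).re else 0) -
      Real.log (∑ x' : TorusSite 2 M, ∑ y' : TorusSite 2 M,
        if (∀ i : Fin 2, (x' i).val / b = (X i).val) ∧ (∀ i : Fin 2, (y' i).val / b = 0)
        then (star ψ ⬝ᵥ (onSite x' (spinRaise 1) * onSite y' (spinLower 1)) *ᵥ ψ).re else 0))) /
      (m : ℝ) ^ 2 ≤ Real.log 3 := by
  classical
  set k : TorusSite 2 m → ℝ := fun X => ∑ x' : TorusSite 2 M, ∑ y' : TorusSite 2 M,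
      if (∀ i : Fin 2, (x' i).val / b = (X i).val) ∧ (∀ i : Fin 2, (y' i).val / b = 0)
      then (star ψ ⬝ᵥ (onSite x' (spinRaise 1) * onSite y' (spinLower 1)) *ᵥ ψ).re else 0 with hk
  set L : ℝ := (b : ℝ) ^ 4 * (∑ x : TorusSite 2 M, ∑ y : TorusSite 2 M,
      (star ψ ⬝ᵥ (onSite x (spinRaise 1) * onSite y (spinLower 1)) *ᵥ ψ).re) / (M : ℝ) ^ 4 with hL
  set c : ℝ := 18 * Real.sqrt (1 - Δ) * (b : ℝ) ^ 3 with hc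
  have hMpos : (0 : ℝ) < M := by exact_mod_cast Nat.pos_of_ne_zero (NeZero.ne M)
  have hmpos : (0 : ℝ) < m := by exact_mod_cast Nat.pos_of_ne_zero (NeZero.ne m)
  have hb : (0 : ℝ) < b := by exact_mod_cast TorusBlock.pos_of_eq_mul hMb
  have hs1 : 1 ≤ Real.sqrt (1 - Δ) := Real.le_sqrt_of_sq_le (by nlinarith)
  have hapos : 0 < a := by
    by_contra h
    push Not at h
    have : a * b ≤ 0 := mul_nonpos_of_nonpos_of_nonneg h hb.le
    linarith
  have hLa : a * (b : ℝ) ^ 4 ≤ L := by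
    rw [hL, le_div_iff₀ (by positivity)]
    nlinarith [pow_pos hb 4]
  have hcL : 2 * c ≤ L := by
    have : 18 * Real.sqrt (1 - Δ) ≤ a * b / 2 := by linarith
    have h2 : c ≤ a / 2 * (b : ℝ) ^ 4 := by rw [hc]; nlinarith [pow_pos hb 3]
    linarith
  have hc0 : 0 ≤ c := by positivity
  have habs : ∀ X, |k X - L| ≤ c := fun X =>
    sectorGS_abs_coarseKernel_sub_le M hMb hEven h4 hΔ ψ hψ hnorm heig X
  have hlow : ∀ X, L - c ≤ k X := fun X => by have := (abs_le.1 (habs X)).1; linarith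
  have hup : ∀ X, k X ≤ L + c := fun X => by have := (abs_le.1 (habs X)).2; linarith
  have hLc : 0 < L - c := by linarith [mul_pos hapos (pow_pos hb 4)]
  have hterm : ∀ X, Real.log (k 0) - Real.log (k X) ≤ Real.log 3 := by
    intro X
    have e1 : Real.log (k 0) ≤ Real.log (L + c) := Real.log_le_log (hLc.trans_le (hlow 0)) (hup 0)
    have e2 : Real.log (L - c) ≤ Real.log (k X) := Real.log_le_log hLc (hlow X)
    have e3 : Real.log (L + c) - Real.log (L - c) ≤ Real.log 3 := by
      rw [← Real.log_div (by linarith) hLc.ne']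
      exact Real.log_le_log (div_pos (by linarith) hLc) (by rw [div_le_iff₀ hLc]; linarith)
    linarith
  have hk00 : k 0 = ∑ x' : TorusSite 2 M, ∑ y' : TorusSite 2 M,
      if (∀ i : Fin 2, (x' i).val / b = ((0 : TorusSite 2 m) i).val) ∧ (∀ i : Fin 2, (y' i).val / b = 0)
      then (star ψ ⬝ᵥ (onSite x' (spinRaise 1) * onSite y' (spinLower 1)) *ᵥ ψ).re else 0 := rfl
  rw [← hk00, div_le_iff₀ (by positivity)]
  calc ∑ X : TorusSite 2 m, (Real.log (k 0) - Real.log (k X))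
      ≤ ∑ _X : TorusSite 2 m, Real.log 3 := Finset.sum_le_sum fun X _ => hterm X
    _ = Real.log 3 * (m : ℝ) ^ 2 := by
        rw [Finset.sum_const, Finset.card_univ, TorusBlock.card_torusSite_eq_pow, nsmul_eq_mul]
        push_cast
        ring

/-- **`sectorGS_coarseLevyMass_le_log_three_all`** (registered sub-goal of
stmt-HubbardSuperconductivity-15049; `∀`-closed form of `sectorGS_coarseLevyMass_le_log_three`): for
even `M = b·m ≥ 4`, `Δ ≤ 0`, every normalised half-filled sector ground state `ψ` of `H_M(Δ)` with
planar order `Σ_{x,y} Re⟨ψ,S⁺_xS⁻_yψ⟩ ≥ a M⁴` and every block size with `a·b ≥ 36√(1-Δ)`, the coarse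
Lévy mass of the `b`-block transverse kernel is at most `log 3`. [cite: KLS1988JSP, eqs. (17)–(19)] -/
theorem sectorGS_coarseLevyMass_le_log_three_all :
    ∀ (M : ℕ) [NeZero M] (m b : ℕ) [NeZero m], M = b * m → Even M → 4 ≤ M →
      ∀ (Δ : ℝ), Δ ≤ 0 → ∀ (ψ : TensorIndex (TorusSite 2 M) 2 → ℂ),
      ψ ∈ @spinZSector (TorusSite 2 M) _ _ 1 0 → star ψ ⬝ᵥ ψ = 1 →
      Matrix.mulVec (xxzHamiltonian 1 (torusGraph 2 M) (-1) Δ) ψ =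
        ((lowestEnergyInSector 1 (xxzHamiltonian 1 (torusGraph 2 M) (-1) Δ) 0 : ℝ) : ℂ) • ψ →
      ∀ (a : ℝ), a * (M : ℝ) ^ 4 ≤ (∑ x : TorusSite 2 M, ∑ y : TorusSite 2 M,
        (star ψ ⬝ᵥ (onSite x (spinRaise 1) * onSite y (spinLower 1)) *ᵥ ψ).re) →
      36 * Real.sqrt (1 - Δ) ≤ a * b →
      (∑ X : TorusSite 2 m, (Real.log (∑ x' : TorusSite 2 M, ∑ y' : TorusSite 2 M,
          if (∀ i : Fin 2, (x' i).val / b = ((0 : TorusSite 2 m) i).val) ∧ (∀ i : Fin 2, (y' i).val / b = 0)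
          then (star ψ ⬝ᵥ (onSite x' (spinRaise 1) * onSite y' (spinLower 1)) *ᵥ ψ).re else 0) -
        Real.log (∑ x' : TorusSite 2 M, ∑ y' : TorusSite 2 M,
          if (∀ i : Fin 2, (x' i).val / b = (X i).val) ∧ (∀ i : Fin 2, (y' i).val / b = 0)
          then (star ψ ⬝ᵥ (onSite x' (spinRaise 1) * onSite y' (spinLower 1)) *ᵥ ψ).re else 0))) /
        (m : ℝ) ^ 2 ≤ Real.log 3 :=
  fun M _ _ _ _ hMb hEven h4 _ hΔ ψ hψ hnorm heig _ ha hab =>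
    sectorGS_coarseLevyMass_le_log_three M hMb hEven h4 hΔ ψ hψ hnorm heig ha hab

end Main

end Summit.HubbardSuperconductivity.HubbardSuperconductivity.Theorems.LevyLogBootstrap
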